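import Mathlib
import HarnessLib
import Literature.Probability.MarkovChains.MetropolisHastings
import Summits.Ventures.LatticeQCDFlow.Exactness.TemperedTransitions

/-!
# Tempered transitions with deterministic coupling layers (NCMC) are exact: skew detailed balance

HONEST FRAMING: exact (Metropolis-corrected) sampling algorithms for lattice gauge theory;
figures of merit are autocorrelation/cost numbers at stated couplings and volumes; no
continuum-physics claim.

Venture `LatticeQCDFlow` (cell pub-lqcd), topic `Exactness`; FANOUT row 13 (`eng-snf`, the
`latflow-snf` protocol engine, module `snf.tempered` from release 0.1.2: `tempered_transition(layers=)`).
NEW WORK of the cell (elementary finite sums), not a published result.  The constructions formalised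
are named only, nothing is cited as a fact: R. M. Neal, Statistics and Computing 6 (1996) 353, §3
(tempered transitions); J. P. Nilmeier, G. E. Crooks, D. D. L. Minh, J. D. Chodera, PNAS 108 (2011)
E1009 (non-equilibrium candidate Monte Carlo: deterministic maps interleaved with stochastic
kernels, accepted with the generalised work); M. Caselle, E. Cellini, A. Nada, M. Panero, JHEP 07
(2022) 015 (stochastic normalizing flows: the same work with the Jacobian of the coupling layers).

## Content

`TemperedTransitions.lean` proves that Neal's round-trip kernel is in detailed balance with the
target weight when every level's up/down kernels are MUTUALLY REVERSIBLE for that level's Boltzmann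
weight, the work being the sum of the switching costs `S (i+1) (u i) - S i (u i)`.  Release 0.1.2 of
`latflow-snf` inserts DETERMINISTIC COUPLING LAYERS `g i` (bijections of the configuration space,
e.g. plaquette Möbius / stout layers) before each switch on the way up and their inverses after each
switch on the way down, and books the generalised work `S (i+1) (g i (u i)) - S i (u i)` (minus
`log |det J|`, which vanishes on a finite space).  The composite up-step "apply `g i`, switch, relax
with `T i`" is no longer reversible for any single weight, so the hypothesis of the earlier file does
not apply verbatim.  What survives is a SKEW balance between consecutive levels:

* `SkewBalance π π' K Kadj w` :  `π a · K a b · e^{-w a b} = π' b · Kadj b a` — the up-step kernel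
  `K`, the down-step kernel `Kadj` and the booked work `w` are balanced between the weight `π`
  below and the weight `π'` above.  Instances: a switch followed by a mutually reversible kernel
  (`skewBalance_switch`, Neal's case); a deterministic layer, then the switch, then the kernel
  (`skewBalance_layer`, the NCMC / SNF case — for ANY map `g`; bijectivity is only needed to RUN the
  down pass, `layerDown_eq_sum`); a weight-preserving bijection with zero work
  (`skewBalance_symmetry`, e.g. an over-relaxation reflection).
* `skewCrooks_pathwise` — the one-way pathwise (Crooks) identity
  `π 0 (x 0) · up(x) · e^{-W(x)} = π N (x N) · down(x)` by telescoping the skew balances;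
* `skewRoundTrip_pathwise` — hence Neal's round-trip identity
  `π 0 (u 0) · up(u) · down(d) · e^{-(W u - W d)} = π 0 (d 0) · up(d) · down(u)` when `u N = d N`;
* `skewMove_detailedBalance`, `skewKernel_detailedBalance`, `skewKernel_isStationary` — the
  accepted-move weights with acceptance `min 1 e^{-(W u - W d)}`, completed by the rejection mass,
  form a kernel in detailed balance with (hence leaving invariant) the target weight `π 0`, for ANY
  number of levels and ANY non-negative kernels / works in skew balance level by level; only
  `0 ≤ π 0` is used, no normalisation anywhere;
* `layeredTemperedKernel_detailedBalance`, `layeredTemperedKernel_isStationary` — THE CASE OF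
  RECORD: tempered transitions through actions `S 0 … S N` with mutually reversible relaxation
  kernels `T i / Tadj i` and arbitrary layer maps `g i` inserted before the switches, work
  `Σ_i [S (i+1) (g i (u i)) - S i (u i)] - Σ_i [S (i+1) (g i (d i)) - S i (d i)]`, are exact for
  `e^{-S 0}`;
* `roundTripWork_eq_pathWork` — with all `g i = id` the work is the `roundTripWork` of
  `TemperedTransitions.lean` (the earlier theorem is the layer-free instance).

Dictionary: `X` = a finite discretisation of the gauge-field configuration space (unit Jacobians);
`S i` = the interpolating actions of the defect protocol read from the TARGET end; `T i`/`Tadj i` =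
heat-bath(+over-relaxation) sweeps and their reverse-order sweeps at level `i+1`; `g i` = the
coupling layer applied at level `i` on the way up (its inverse on the way down).  On a continuous
space the booked work carries `- log |det J_{g i}|` in addition (the Radon–Nikodym factor, `1` here).
-/

namespace Summit.Ventures.LatticeQCDFlow.Exactness

open Finset
open Literature.Probability.MarkovChains

variable {X : Type*} [Fintype X]

/-! ## Skew balance of one protocol step -/

/-- SKEW BALANCE of one protocol step between the weight `π` (level below) and `π'` (level
above): the up-step kernel `K`, the down-step kernel `Kadj` (read `Kadj b a` = probability of the
down move `b → a`) and the work `w a b` booked for the up move `a → b` satisfy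
`π a · K a b · e^{-w a b} = π' b · Kadj b a`.  The down move books `-w a b`.  The per-step
form of Crooks' microscopic reversibility; a standard bookkeeping notion, no single source.
[folklore] -/
@[folklore]
def SkewBalance (π π' : X → ℝ) (K Kadj : X → X → ℝ) (w : X → X → ℝ) : Prop :=
  ∀ a b, π a * K a b * Real.exp (-w a b) = π' b * Kadj b a

omit [Fintype X] in
/-- Neal's step: book the switch `S → S'` at the current point, then move with a kernel `T`
that is mutually reversible (with `Tadj`) for `e^{-S'}`.  This is in skew balance between
`e^{-S}` and `e^{-S'}` with work `S' a - S a`. -/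
theorem skewBalance_switch (S S' : X → ℝ) {T Tadj : X → X → ℝ}
    (hrev : MutuallyReversible (fun x => Real.exp (-S' x)) T Tadj) :
    SkewBalance (fun x => Real.exp (-S x)) (fun x => Real.exp (-S' x)) T Tadj
      (fun a _ => S' a - S a) := by
  intro a b
  have h := hrev a b
  calc Real.exp (-S a) * T a b * Real.exp (-(S' a - S a))
      = (Real.exp (-S a) * Real.exp (-(S' a - S a))) * T a b := by ring
    _ = Real.exp (-S' a) * T a b := by
        rw [← Real.exp_add, show -S a + -(S' a - S a) = -S' a by ring]
    _ = Real.exp (-S' b) * Tadj b a := h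

omit [Fintype X] in
/-- NCMC / SNF step: apply a deterministic LAYER `g`, book the generalised work
`S' (g a) - S a` (switch cost at the mapped point plus the change of `S` under the map; unit
Jacobian), then move with a kernel `T` mutually reversible (with `Tadj`) for `e^{-S'}`.  The
composite up-kernel `a ↦ T (g a) ·` and the composite down-kernel `Kadj b a = Tadj b (g a)`
("move with `Tadj`, then undo the layer") are in skew balance between `e^{-S}` and `e^{-S'}`.
The identity holds for ANY map `g`; `g` must be a bijection only for the down-kernel to be a
bona fide sampling procedure (`layerDown_eq_sum`). -/
theorem skewBalance_layer (S S' : X → ℝ) {T Tadj : X → X → ℝ} (g : X → X)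
    (hrev : MutuallyReversible (fun x => Real.exp (-S' x)) T Tadj) :
    SkewBalance (fun x => Real.exp (-S x)) (fun x => Real.exp (-S' x)) (fun a b => T (g a) b)
      (fun b a => Tadj b (g a)) (fun a _ => S' (g a) - S a) := by
  intro a b
  have h := hrev (g a) b
  calc Real.exp (-S a) * T (g a) b * Real.exp (-(S' (g a) - S a))
      = (Real.exp (-S a) * Real.exp (-(S' (g a) - S a))) * T (g a) b := by ring
    _ = Real.exp (-S' (g a)) * T (g a) b := by
        rw [← Real.exp_add, show -S a + -(S' (g a) - S a) = -S' (g a) by ring]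
    _ = Real.exp (-S' b) * Tadj b (g a) := h

/-- Operational meaning of the composite down-kernel for a BIJECTIVE layer `g`: "draw `y` from
`Tadj b ·`, then return `g⁻¹ y`" has transition weight `Σ_y Tadj b y · [a = g⁻¹ y] = Tadj b (g a)`. -/
theorem layerDown_eq_sum [DecidableEq X] (Tadj : X → X → ℝ) (g : X ≃ X) (b a : X) :
    ∑ y, Tadj b y * (if a = g.symm y then 1 else 0) = Tadj b (g a) := by
  have hiff : ∀ y, (a = g.symm y) ↔ (g a = y) := fun y => by
    constructor
    · intro h; rw [h, Equiv.apply_symm_apply]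
    · intro h; rw [← h, Equiv.symm_apply_apply]
  simp_rw [hiff]
  rw [Finset.sum_eq_single (g a)]
  · simp
  · intro y _ hy
    rw [if_neg (fun h => hy h.symm), mul_zero]
  · intro h; exact absurd (mem_univ _) h

omit [Fintype X] in
/-- A weight-preserving bijection `h` (`S ∘ h = S`, e.g. an over-relaxation reflection) used as a
deterministic move with ZERO work, paired with `h⁻¹` on the way down, is in skew balance between
`e^{-S}` and itself. -/
theorem skewBalance_symmetry [DecidableEq X] (S : X → ℝ) (h : X ≃ X) (hS : ∀ x, S (h x) = S x) :
    SkewBalance (fun x => Real.exp (-S x)) (fun x => Real.exp (-S x))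
      (fun a b => if b = h a then 1 else 0) (fun b a => if a = h.symm b then 1 else 0)
      (fun _ _ => 0) := by
  intro a b
  dsimp only
  by_cases hb : b = h a
  · have ha : a = h.symm b := by rw [hb, Equiv.symm_apply_apply]
    rw [if_pos hb, if_pos ha, hb, hS a, neg_zero, Real.exp_zero]
    ring
  · have ha : ¬ a = h.symm b := fun ha => hb (by rw [ha, Equiv.apply_symm_apply])
    rw [if_neg hb, if_neg ha]
    simp

/-! ## Path work and the one-way (Crooks) identity under skew balance -/

/-- Work booked along a path `x 0 → x 1 → ⋯ → x N` with per-step work functions `w i`. -/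
noncomputable def pathWork {N : ℕ} (w : Fin N → X → X → ℝ) (x : Fin (N + 1) → X) : ℝ :=
  ∑ i : Fin N, w i (x i.castSucc) (x i.succ)

omit [Fintype X] in
/-- Peeling the first step off `pathWork`. -/
theorem pathWork_cons {N : ℕ} (w : Fin (N + 1) → X → X → ℝ) (x₀ : X) (x : Fin (N + 1) → X) :
    pathWork w (Fin.cons x₀ x : Fin (N + 2) → X) = w 0 x₀ (x 0) + pathWork (fun i => w i.succ) x := by
  unfold pathWork
  rw [Fin.sum_univ_succ]
  simp only [Fin.castSucc_zero, Fin.cons_zero, Fin.cons_succ, Fin.castSucc_succ]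

omit [Fintype X] in
/-- **One-way pathwise identity (Crooks) under skew balance.**  If every step is in skew balance
between consecutive level weights, then for EVERY path `x`:
`π 0 (x 0) · up(x) · e^{-W(x)} = π N (x N) · down(x)`. -/
theorem skewCrooks_pathwise : ∀ {N : ℕ} (π : Fin (N + 1) → X → ℝ) (K Kadj : Fin N → X → X → ℝ)
    (w : Fin N → X → X → ℝ),
    (∀ i : Fin N, SkewBalance (π i.castSucc) (π i.succ) (K i) (Kadj i) (w i)) →
    ∀ x : Fin (N + 1) → X,
      π 0 (x 0) * upProb K x * Real.exp (-pathWork w x) =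
        π (Fin.last N) (x (Fin.last N)) * downProb Kadj x
  | 0, π, K, Kadj, w, _, x => by
    simp [upProb, downProb, pathWork]
  | N + 1, π, K, Kadj, w, hsk, x => by
    obtain ⟨x₀, y, rfl⟩ : ∃ x₀ y, x = Fin.cons x₀ y := ⟨x 0, Fin.tail x, (Fin.cons_self_tail x).symm⟩
    have ih := skewCrooks_pathwise (N := N) (fun i => π i.succ) (fun i => K i.succ)
      (fun i => Kadj i.succ) (fun i => w i.succ) (fun i => hsk i.succ) y
    have hlast : (Fin.cons x₀ y : Fin (N + 2) → X) (Fin.last (N + 1)) = y (Fin.last N) := by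
      rw [← Fin.succ_last, Fin.cons_succ]
    rw [upProb_cons, downProb_cons, pathWork_cons, Fin.cons_zero, hlast]
    have h0 := hsk 0 x₀ (y 0)
    simp only [Fin.castSucc_zero, Fin.succ_zero_eq_one] at h0
    simp only [Fin.succ_zero_eq_one, Fin.succ_last] at ih
    set A := upProb (fun i => K i.succ) y with hA
    set B := downProb (fun i => Kadj i.succ) y with hB
    set pw := pathWork (fun i => w i.succ) y with hpw
    rw [neg_add, Real.exp_add]
    calc π 0 x₀ * (K 0 x₀ (y 0) * A) * (Real.exp (-w 0 x₀ (y 0)) * Real.exp (-pw))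
        = (π 0 x₀ * K 0 x₀ (y 0) * Real.exp (-w 0 x₀ (y 0))) * (A * Real.exp (-pw)) := by ring
      _ = (π 1 (y 0) * Kadj 0 (y 0) x₀) * (A * Real.exp (-pw)) := by rw [h0]
      _ = Kadj 0 (y 0) x₀ * (π 1 (y 0) * A * Real.exp (-pw)) := by ring
      _ = Kadj 0 (y 0) x₀ * (π (Fin.last (N + 1)) (y (Fin.last N)) * B) := by rw [ih]
      _ = π (Fin.last (N + 1)) (y (Fin.last N)) * (Kadj 0 (y 0) x₀ * B) := by ring

omit [Fintype X] in
/-- **Round-trip pathwise identity under skew balance (Neal).**  For an up-path `u` and a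
down-path `d` meeting at the top (`u N = d N`):
`π 0 (u 0) · up(u) · down(d) · e^{-(W u - W d)} = π 0 (d 0) · up(d) · down(u)` — the time
reversal of the round trip `(u, d)` is `(d, u)`.  Two applications of `skewCrooks_pathwise`. -/
theorem skewRoundTrip_pathwise {N : ℕ} (π : Fin (N + 1) → X → ℝ) (K Kadj : Fin N → X → X → ℝ)
    (w : Fin N → X → X → ℝ)
    (hsk : ∀ i : Fin N, SkewBalance (π i.castSucc) (π i.succ) (K i) (Kadj i) (w i))
    (u d : Fin (N + 1) → X) (htop : u (Fin.last N) = d (Fin.last N)) :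
    π 0 (u 0) * upProb K u * downProb Kadj d * Real.exp (-(pathWork w u - pathWork w d)) =
      π 0 (d 0) * upProb K d * downProb Kadj u := by
  have hu := skewCrooks_pathwise π K Kadj w hsk u
  have hd := skewCrooks_pathwise π K Kadj w hsk d
  rw [htop] at hu
  have e1 : Real.exp (-(pathWork w u - pathWork w d)) =
      Real.exp (-pathWork w u) * Real.exp (pathWork w d) := by rw [← Real.exp_add]; congr 1; ring
  have e2 : Real.exp (-pathWork w d) * Real.exp (pathWork w d) = 1 := by rw [← Real.exp_add]; simp
  calc π 0 (u 0) * upProb K u * downProb Kadj d * Real.exp (-(pathWork w u - pathWork w d))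
      = (π 0 (u 0) * upProb K u * Real.exp (-pathWork w u)) * downProb Kadj d *
          Real.exp (pathWork w d) := by rw [e1]; ring
    _ = (π (Fin.last N) (d (Fin.last N)) * downProb Kadj u) * downProb Kadj d *
          Real.exp (pathWork w d) := by rw [hu]
    _ = (π (Fin.last N) (d (Fin.last N)) * downProb Kadj d) * Real.exp (pathWork w d) *
          downProb Kadj u := by ring
    _ = (π 0 (d 0) * upProb K d * Real.exp (-pathWork w d)) * Real.exp (pathWork w d) *
          downProb Kadj u := by rw [hd]
    _ = π 0 (d 0) * upProb K d * (Real.exp (-pathWork w d) * Real.exp (pathWork w d)) *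
          downProb Kadj u := by ring
    _ = π 0 (d 0) * upProb K d * downProb Kadj u := by rw [e2, mul_one]

/-! ## The tempered-transition kernel under skew balance -/

section Kernel

variable [DecidableEq X]

/-- Accepted-move weight of the generalised tempered transition from `x` to the candidate `x'`:
total probability over up-paths from `x` and down-paths to `x'` meeting at the top of proposing the
round trip AND accepting it with `min 1 e^{-(W u - W d)}`.  (Independent of the level weights.) -/
noncomputable def skewMove {N : ℕ} (K Kadj : Fin N → X → X → ℝ) (w : Fin N → X → X → ℝ)
    (x x' : X) : ℝ :=
  ∑ u : Fin (N + 1) → X, ∑ d : Fin (N + 1) → X,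
    if u 0 = x ∧ d 0 = x' ∧ u (Fin.last N) = d (Fin.last N) then
      upProb K u * downProb Kadj d * min 1 (Real.exp (-(pathWork w u - pathWork w d))) else 0

/-- **Detailed balance of the generalised tempered transition (accepted moves).**  For
non-negative kernels and works in skew balance level by level and a non-negative target weight
`π 0`: `π 0 x · M x x' = π 0 x' · M x' x`.  Pair `(u, d)` with `(d, u)` and use
`skewRoundTrip_pathwise` inside `min`. -/
theorem skewMove_detailedBalance {N : ℕ} (π : Fin (N + 1) → X → ℝ) (K Kadj : Fin N → X → X → ℝ)
    (w : Fin N → X → X → ℝ) (hK : ∀ i a b, 0 ≤ K i a b) (hKadj : ∀ i a b, 0 ≤ Kadj i a b)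
    (hπ : ∀ x, 0 ≤ π 0 x)
    (hsk : ∀ i : Fin N, SkewBalance (π i.castSucc) (π i.succ) (K i) (Kadj i) (w i)) :
    DetailedBalance (π 0) (skewMove K Kadj w) := by
  intro x x'
  simp only [skewMove, mul_sum]
  conv_rhs => rw [sum_comm]
  refine sum_congr rfl fun u _ => sum_congr rfl fun d _ => ?_
  by_cases h : u 0 = x ∧ d 0 = x' ∧ u (Fin.last N) = d (Fin.last N)
  · obtain ⟨hu, hd, htop⟩ := h
    have h' : d 0 = x' ∧ u 0 = x ∧ d (Fin.last N) = u (Fin.last N) := ⟨hd, hu, htop.symm⟩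
    rw [if_pos ⟨hu, hd, htop⟩, if_pos h']
    have key := skewRoundTrip_pathwise π K Kadj w hsk u d htop
    have hA : 0 ≤ π 0 (u 0) * upProb K u * downProb Kadj d :=
      mul_nonneg (mul_nonneg (hπ _) (upProb_nonneg hK u)) (downProb_nonneg hKadj d)
    have hB : 0 ≤ π 0 (d 0) * upProb K d * downProb Kadj u :=
      mul_nonneg (mul_nonneg (hπ _) (upProb_nonneg hK d)) (downProb_nonneg hKadj u)
    have hW : Real.exp (-(pathWork w d - pathWork w u)) =
        (Real.exp (-(pathWork w u - pathWork w d)))⁻¹ := by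
      rw [← Real.exp_neg]; congr 1; ring
    rw [← hu, ← hd]
    calc π 0 (u 0) * (upProb K u * downProb Kadj d * min 1 (Real.exp (-(pathWork w u - pathWork w d))))
        = (π 0 (u 0) * upProb K u * downProb Kadj d) *
            min 1 (Real.exp (-(pathWork w u - pathWork w d))) := by ring
      _ = min (π 0 (u 0) * upProb K u * downProb Kadj d)
            (π 0 (d 0) * upProb K d * downProb Kadj u) := by
          rw [mul_min_of_nonneg _ _ hA, mul_one, key]
      _ = min (π 0 (d 0) * upProb K d * downProb Kadj u)
            ((π 0 (d 0) * upProb K d * downProb Kadj u) *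
              Real.exp (-(pathWork w d - pathWork w u))) := by
          rw [min_comm, hW, ← key, mul_assoc (π 0 (u 0) * upProb K u * downProb Kadj d),
            mul_inv_cancel₀ (Real.exp_pos _).ne', mul_one]
      _ = (π 0 (d 0) * upProb K d * downProb Kadj u) *
            min 1 (Real.exp (-(pathWork w d - pathWork w u))) := by
          rw [mul_min_of_nonneg _ _ hB, mul_one]
      _ = π 0 (d 0) * (upProb K d * downProb Kadj u *
            min 1 (Real.exp (-(pathWork w d - pathWork w u)))) := by ring
  · have h' : ¬(d 0 = x' ∧ u 0 = x ∧ d (Fin.last N) = u (Fin.last N)) := by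
      rintro ⟨hd, hu, htop⟩; exact h ⟨hu, hd, htop.symm⟩
    rw [if_neg h, if_neg h', mul_zero, mul_zero]

/-- The full generalised tempered-transition kernel: accepted moves plus the rejection / no-move
mass on the diagonal. -/
noncomputable def skewKernel {N : ℕ} (K Kadj : Fin N → X → X → ℝ) (w : Fin N → X → X → ℝ)
    (x x' : X) : ℝ :=
  skewMove K Kadj w x x' + if x' = x then 1 - ∑ y, skewMove K Kadj w x y else 0

/-- **Exactness of generalised tempered transitions.**  Under level-by-level skew balance the
kernel is in detailed balance with the target weight `π 0` — for ANY number of levels, ANY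
non-negative kernels and ANY booked works satisfying the skew balances. -/
theorem skewKernel_detailedBalance {N : ℕ} (π : Fin (N + 1) → X → ℝ) (K Kadj : Fin N → X → X → ℝ)
    (w : Fin N → X → X → ℝ) (hK : ∀ i a b, 0 ≤ K i a b) (hKadj : ∀ i a b, 0 ≤ Kadj i a b)
    (hπ : ∀ x, 0 ≤ π 0 x)
    (hsk : ∀ i : Fin N, SkewBalance (π i.castSucc) (π i.succ) (K i) (Kadj i) (w i)) :
    DetailedBalance (π 0) (skewKernel K Kadj w) := by
  intro x x'
  unfold skewKernel
  have hM := skewMove_detailedBalance π K Kadj w hK hKadj hπ hsk x x'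
  by_cases hxx : x' = x
  · subst hxx
    rfl
  · have hxx' : ¬x = x' := fun h => hxx h.symm
    rw [if_neg hxx, if_neg hxx', add_zero, add_zero]
    exact hM

/-- The rows of the generalised tempered-transition kernel sum to one. -/
theorem skewKernel_sum_eq_one {N : ℕ} (K Kadj : Fin N → X → X → ℝ) (w : Fin N → X → X → ℝ)
    (x : X) : ∑ x', skewKernel K Kadj w x x' = 1 := by
  unfold skewKernel
  rw [sum_add_distrib, sum_ite_eq' univ x, if_pos (mem_univ x)]
  ring

/-- Hence the target weight `π 0` is invariant under the generalised tempered-transition kernel. -/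
theorem skewKernel_isStationary {N : ℕ} (π : Fin (N + 1) → X → ℝ) (K Kadj : Fin N → X → X → ℝ)
    (w : Fin N → X → X → ℝ) (hK : ∀ i a b, 0 ≤ K i a b) (hKadj : ∀ i a b, 0 ≤ Kadj i a b)
    (hπ : ∀ x, 0 ≤ π 0 x)
    (hsk : ∀ i : Fin N, SkewBalance (π i.castSucc) (π i.succ) (K i) (Kadj i) (w i)) :
    IsStationary (π 0) (skewKernel K Kadj w) :=
  (skewKernel_detailedBalance π K Kadj w hK hKadj hπ hsk).isStationary
    (skewKernel_sum_eq_one K Kadj w)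

end Kernel

/-! ## The case of record: tempered transitions with coupling layers (latflow-snf 0.1.2) -/

/-- Up-kernel of level `i+1` preceded by the layer `g i`: `a ↦ T i (g i a) ·`. -/
def layerUp {N : ℕ} (T : Fin N → X → X → ℝ) (g : Fin N → X → X) (i : Fin N) (a b : X) : ℝ :=
  T i (g i a) b

/-- Down-kernel of level `i+1` followed by undoing the layer: weight of the down move `b → a` is
`Tadj i b (g i a)` (for a bijective layer: move with `Tadj i`, then apply `(g i)⁻¹`,
`layerDown_eq_sum`). -/
def layerDown {N : ℕ} (Tadj : Fin N → X → X → ℝ) (g : Fin N → X → X) (i : Fin N) (b a : X) : ℝ :=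
  Tadj i b (g i a)

/-- Generalised work booked on the up move out of level `i`: the layer's change of action plus the
switch at the mapped point, `S (i+1) (g i a) - S i a` (unit Jacobian on a finite space). -/
def layerWork {N : ℕ} (S : Fin (N + 1) → X → ℝ) (g : Fin N → X → X) (i : Fin N) (a _b : X) : ℝ :=
  S i.succ (g i a) - S i.castSucc a

omit [Fintype X] in
/-- Every layered level step is in skew balance between `e^{-S i}` and `e^{-S (i+1)}`. -/
theorem layered_skewBalance {N : ℕ} (S : Fin (N + 1) → X → ℝ) (T Tadj : Fin N → X → X → ℝ)
    (g : Fin N → X → X)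
    (hrev : ∀ i : Fin N, MutuallyReversible (fun x => Real.exp (-S i.succ x)) (T i) (Tadj i))
    (i : Fin N) :
    SkewBalance (fun x => Real.exp (-S i.castSucc x)) (fun x => Real.exp (-S i.succ x))
      (layerUp T g i) (layerDown Tadj g i) (layerWork S g i) :=
  skewBalance_layer (S i.castSucc) (S i.succ) (g i) (hrev i)

/-- **Exactness of tempered transitions with deterministic coupling layers (the chain mode of
`latflow-snf` 0.1.2 with `layers=`).**  For ANY protocol `S`, ANY relaxation kernels mutually
reversible level by level and ANY layer maps `g i` (bijections in practice), the round-trip kernel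
— layers and switches on the way up, adjoint kernels, reversed switches and inverse layers on the
way down, acceptance `min 1 e^{-W}` with the generalised work — is in detailed balance with the
target Boltzmann weight `e^{-S 0}`. -/
theorem layeredTemperedKernel_detailedBalance [DecidableEq X] {N : ℕ} (S : Fin (N + 1) → X → ℝ)
    (T Tadj : Fin N → X → X → ℝ) (g : Fin N → X → X)
    (hT : ∀ i a b, 0 ≤ T i a b) (hTadj : ∀ i a b, 0 ≤ Tadj i a b)
    (hrev : ∀ i : Fin N, MutuallyReversible (fun x => Real.exp (-S i.succ x)) (T i) (Tadj i)) :
    DetailedBalance (fun x => Real.exp (-S 0 x))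
      (skewKernel (layerUp T g) (layerDown Tadj g) (layerWork S g)) :=
  skewKernel_detailedBalance (fun i x => Real.exp (-S i x)) (layerUp T g) (layerDown Tadj g)
    (layerWork S g) (fun i _ _ => hT i _ _) (fun i _ _ => hTadj i _ _)
    (fun _ => (Real.exp_pos _).le) (layered_skewBalance S T Tadj g hrev)

/-- Hence the layered tempered-transition chain leaves `e^{-S 0}` invariant: it samples the target
exactly whatever the layers, the protocol length or the mixing of the sweeps (these only set the
acceptance rate). -/
theorem layeredTemperedKernel_isStationary [DecidableEq X] {N : ℕ} (S : Fin (N + 1) → X → ℝ)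
    (T Tadj : Fin N → X → X → ℝ) (g : Fin N → X → X)
    (hT : ∀ i a b, 0 ≤ T i a b) (hTadj : ∀ i a b, 0 ≤ Tadj i a b)
    (hrev : ∀ i : Fin N, MutuallyReversible (fun x => Real.exp (-S i.succ x)) (T i) (Tadj i)) :
    IsStationary (fun x => Real.exp (-S 0 x))
      (skewKernel (layerUp T g) (layerDown Tadj g) (layerWork S g)) :=
  (layeredTemperedKernel_detailedBalance S T Tadj g hT hTadj hrev).isStationary
    (skewKernel_sum_eq_one _ _ _)

omit [Fintype X] in
/-- Consistency with `TemperedTransitions.lean`: without layers (`g i = id`) the booked work of a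
round trip is exactly `roundTripWork`. -/
theorem roundTripWork_eq_pathWork {N : ℕ} (S : Fin (N + 1) → X → ℝ) (u d : Fin (N + 1) → X) :
    roundTripWork S u d =
      pathWork (layerWork S (fun _ => id)) u - pathWork (layerWork S (fun _ => id)) d := by
  simp [roundTripWork, pathWork, layerWork]

end Summit.Ventures.LatticeQCDFlow.Exactness
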